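import Mathlib
import Summits.AtomisticToContinuum.FouriersLaw.Theorems.EmbeddedDrudeMourreDrudeDissolutionFluxPointwise
import HarnessLib

/-!
# Pointwise calculus of the two-level gradient flux, II: the level-one and level-two bounds
(crux `EmbeddedDrudeMourre.DrudeDissolution`, item stmt-AtomisticToContinuum-12593; `--supports` file for the
registered sub-goal `flux_pointwise_bound` of stub B1b″ `stub_excursionSecondDifference` of line
`kinetic-polymer-gas-on-the-time-axis`; closes nothing; lead c13 (process B), 2026-08-17)

WHAT. Continuation of `EmbeddedDrudeMourreDrudeDissolutionFluxPointwise` (frame `e : Fin 3 → V`, `dᵢ = ∂ᵢΩ`,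
`D = Σdᵢ²`, `Xᵢ = dᵢ/D`). For an amplitude `F` the divergence of its gradient flux is
`LF = Σᵢ∂ᵢ(F·Xᵢ) = Σᵢ(∂ᵢF·Xᵢ + F·∂ᵢXᵢ)` (`frame_L_eq`), whence at a point with `m² ≤ D`, `|∂²Ω| ≤ n`:
`|LF| ≤ 3f₁/m + 21f₀n/m²` (`frame_L_abs_le`; `|F| ≤ f₀`, `|∂F| ≤ f₁`). Differentiating the level-one formula
(valid on the open set `{D ≠ 0}`) once more and feeding the level-one bound with `F = LG`:
`|L(LG)(p)| ≤ 9g₂/m² + 189g₁n/m³ + 63g₀t/m³ + 1359g₀n²/m⁴` (`frame_LL_abs_le`; on `ℝ³` with explicit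
binders: `flux_pointwise_bound`, the registered sub-goal).

WHY (role). This is the pointwise input of the sup-norm route to B1b″: with `G = W(1−χ_η)` every term is
`≲ η⁻²` on the support (blueprint in the crux NOTES), so `δ²∫|L(LG)| ≲ δ²η⁻²`.
-/

noncomputable section

open Set Filter Function Topology
open scoped Topology BigOperators

namespace Summit.AtomisticToContinuum.FouriersLaw.Theorems.DrudeDissolution.KineticPolymerGasOnTheTimeAxis

variable {V : Type*} [NormedAddCommGroup V] [NormedSpace ℝ V]

section Frame

variable {Ω : V → ℝ} {e : Fin 3 → V} {d : Fin 3 → V → ℝ} {D : V → ℝ} {X : Fin 3 → V → ℝ}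

/-! ### §1 Second derivatives of `Xᵢ` -/

/-- `|∂ₗ'∂ₗXᵢ(p)| ≤ 7t/m² + 102n²/m³`. [folklore] -/
theorem frame_abs_fderiv2_X_le (hΩ : ContDiff ℝ 3 Ω) (hd : ∀ i q, d i q = fderiv ℝ Ω q (e i))
    (hD : ∀ q, D q = ∑ i, d i q ^ 2) (hX : ∀ i q, X i q = d i q / D q) {p : V} {m n t : ℝ}
    (hm : 0 < m) (hmD : m ^ 2 ≤ D p) (i l l' : Fin 3)
    (hn : ∀ k j, |fderiv ℝ (d k) p (e j)| ≤ n)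
    (ht : ∀ k, |fderiv ℝ (fun q => fderiv ℝ (d k) q (e l)) p (e l')| ≤ t) :
    |fderiv ℝ (fun q => fderiv ℝ (X i) q (e l)) p (e l')| ≤ 7 * t / m ^ 2 + 102 * n ^ 2 / m ^ 3 := by
  have hDp : 0 < D p := (pow_pos hm 2).trans_le hmD
  have hn0 : 0 ≤ n := (abs_nonneg _).trans (hn 0 0)
  have ht0 : 0 ≤ t := (abs_nonneg _).trans (ht 0)
  have : X i = fun q => d i q / D q := funext (hX i)
  rw [this]
  have h := fp_quot_second_abs_le (frame_contDiff_d hΩ hd i).contDiffAt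
    (frame_contDiff_D hΩ hd hD).contDiffAt hDp le_rfl (e l) (e l')
    (frame_abs_d_le hD p i) (hn i l) (hn i l') (ht i)
    (frame_abs_fderiv_D_le hΩ hd hD p l fun k => hn k l)
    (frame_abs_fderiv_D_le hΩ hd hD p l' fun k => hn k l')
    (frame_abs_fderiv2_D_le hΩ hd hD p l l' (fun k => hn k l) (fun k => hn k l') ht)
  refine h.trans ?_
  -- rewrite in terms of `s = √(D p)` and compare with the `m`-bound
  set s := Real.sqrt (D p) with hs
  have hs0 : 0 < s := Real.sqrt_pos.2 hDp
  have hsD : s * s = D p := Real.mul_self_sqrt hDp.le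
  have hms : m ≤ s := by rw [hs, ← Real.sqrt_sq hm.le]; exact Real.sqrt_le_sqrt hmD
  have hDeq : D p = s ^ 2 := by rw [sq, hsD]
  rw [hDeq]
  have e1 : t / s ^ 2 + (4 * n * (6 * n * s) + s * (6 * n ^ 2 + 6 * s * t)) / (s ^ 2) ^ 2 +
      2 * s * (6 * n * s) ^ 2 / (s ^ 2) ^ 3 = 7 * t / s ^ 2 + 102 * n ^ 2 / s ^ 3 := by
    field_simp
    ring
  rw [e1]
  gcongr

/-! ### §2 Level one: the divergence of the gradient flux of an amplitude -/

/-- **Level-one formula.** `Σᵢ∂ᵢ(F·Xᵢ)(p) = Σᵢ(∂ᵢF·Xᵢ + F·∂ᵢXᵢ)(p)`. [folklore] -/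
theorem frame_L_eq {F : V → ℝ} {p : V} (hF : DifferentiableAt ℝ F p)
    (hXd : ∀ i, DifferentiableAt ℝ (X i) p) :
    (∑ i, fderiv ℝ (fun q => F q * X i q) p (e i)) =
      ∑ i, (fderiv ℝ F p (e i) * X i p + F p * fderiv ℝ (X i) p (e i)) :=
  Finset.sum_congr rfl fun i _ => fp_mul hF (hXd i) (e i)

/-- **Level-one bound.** At a point with `m² ≤ D(p)` (`m > 0`), `|∂dₖ(p)| ≤ n`, `|F(p)| ≤ f₀`,
`|∂ᵢF(p)| ≤ f₁`: `|Σᵢ∂ᵢ(F·Xᵢ)(p)| ≤ 3f₁/m + 21f₀n/m²`. [folklore] -/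
theorem frame_L_abs_le (hΩ : ContDiff ℝ 3 Ω) (hd : ∀ i q, d i q = fderiv ℝ Ω q (e i))
    (hD : ∀ q, D q = ∑ i, d i q ^ 2) (hX : ∀ i q, X i q = d i q / D q) {p : V} {m n : ℝ}
    (hm : 0 < m) (hmD : m ^ 2 ≤ D p) (hn : ∀ k j, |fderiv ℝ (d k) p (e j)| ≤ n)
    {F : V → ℝ} (hF : DifferentiableAt ℝ F p) {f₀ f₁ : ℝ} (hf₀ : |F p| ≤ f₀)
    (hf₁ : ∀ i, |fderiv ℝ F p (e i)| ≤ f₁) :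
    |∑ i, fderiv ℝ (fun q => F q * X i q) p (e i)| ≤ 3 * f₁ / m + 21 * f₀ * n / m ^ 2 := by
  have hDp : 0 < D p := (pow_pos hm 2).trans_le hmD
  have hXd : ∀ i, DifferentiableAt ℝ (X i) p := fun i =>
    (frame_contDiffAt_X hΩ hd hD hX hDp.ne' i).differentiableAt (by simp)
  rw [frame_L_eq hF hXd]
  have hf₀' : 0 ≤ f₀ := (abs_nonneg _).trans hf₀
  have hf₁' : 0 ≤ f₁ := (abs_nonneg _).trans (hf₁ 0)
  have hterm : ∀ i, |fderiv ℝ F p (e i) * X i p + F p * fderiv ℝ (X i) p (e i)| ≤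
      f₁ * (1 / m) + f₀ * (7 * n / m ^ 2) := by
    intro i
    refine (abs_add_le _ _).trans (add_le_add ?_ ?_)
    · rw [abs_mul]
      exact mul_le_mul (hf₁ i) (frame_abs_X_le hD hX hm hmD i) (abs_nonneg _) hf₁'
    · rw [abs_mul]
      exact mul_le_mul hf₀ (frame_abs_fderiv_X_le hΩ hd hD hX hm hmD i i fun k => hn k i)
        (abs_nonneg _) hf₀'
  calc |∑ i, (fderiv ℝ F p (e i) * X i p + F p * fderiv ℝ (X i) p (e i))|
      ≤ ∑ i, |fderiv ℝ F p (e i) * X i p + F p * fderiv ℝ (X i) p (e i)| :=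
        Finset.abs_sum_le_sum_abs _ _
    _ ≤ ∑ _i : Fin 3, (f₁ * (1 / m) + f₀ * (7 * n / m ^ 2)) := Finset.sum_le_sum fun i _ => hterm i
    _ = 3 * f₁ / m + 21 * f₀ * n / m ^ 2 := by
        rw [Finset.sum_const, Finset.card_univ, Fintype.card_fin]
        simp only [nsmul_eq_mul, Nat.cast_ofNat]
        ring

/-! ### §3 Level two: differentiating the level-one formula -/

/-- **Derivative of the level-one divergence.** For `G ∈ C²` and `LG = Σᵢ∂ᵢ(G·Xᵢ)` (as a function), at
a point with `m² ≤ D(p)`, `|∂dₖ(p)| ≤ n`, `|∂²dₖ(p)| ≤ t`, `|G(p)| ≤ g₀`, `|∂G(p)| ≤ g₁`, `|∂²G(p)| ≤ g₂`: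
`LG` is differentiable at `p` and `|∂ₗ(LG)(p)| ≤ 3g₂/m + 42g₁n/m² + 21g₀t/m² + 306g₀n²/m³`. [folklore] -/
theorem frame_fderiv_L_abs_le (hΩ : ContDiff ℝ 3 Ω) (hd : ∀ i q, d i q = fderiv ℝ Ω q (e i))
    (hD : ∀ q, D q = ∑ i, d i q ^ 2) (hX : ∀ i q, X i q = d i q / D q) {p : V} {m n t : ℝ}
    (hm : 0 < m) (hmD : m ^ 2 ≤ D p) (hn : ∀ k j, |fderiv ℝ (d k) p (e j)| ≤ n)
    (ht : ∀ k i l, |fderiv ℝ (fun q => fderiv ℝ (d k) q (e i)) p (e l)| ≤ t)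
    {G LG : V → ℝ} (hG : ContDiff ℝ 2 G) (hL : ∀ q, LG q = ∑ i, fderiv ℝ (fun r => G r * X i r) q (e i))
    {g₀ g₁ g₂ : ℝ} (hg₀ : |G p| ≤ g₀) (hg₁ : ∀ i, |fderiv ℝ G p (e i)| ≤ g₁)
    (hg₂ : ∀ i l, |fderiv ℝ (fun q => fderiv ℝ G q (e i)) p (e l)| ≤ g₂) (l : Fin 3) :
    DifferentiableAt ℝ LG p ∧
      |fderiv ℝ LG p (e l)| ≤ 3 * g₂ / m + 42 * g₁ * n / m ^ 2 + 21 * g₀ * t / m ^ 2 +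
        306 * g₀ * n ^ 2 / m ^ 3 := by
  have hDp : 0 < D p := (pow_pos hm 2).trans_le hmD
  have hn0 : 0 ≤ n := (abs_nonneg _).trans (hn 0 0)
  have hg₀' : 0 ≤ g₀ := (abs_nonneg _).trans hg₀
  have hg₁' : 0 ≤ g₁ := (abs_nonneg _).trans (hg₁ 0)
  have hg₂' : 0 ≤ g₂ := (abs_nonneg _).trans (hg₂ 0 0)
  -- differentiability everywhere of `dᵢ`, `D`, `G`, `∂ᵢG`
  have hdd : ∀ i, Differentiable ℝ (d i) := fun i => (frame_contDiff_d hΩ hd i).differentiable (by norm_num)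
  have hDd : Differentiable ℝ D := (frame_contDiff_D hΩ hd hD).differentiable (by norm_num)
  have hGd : Differentiable ℝ G := hG.differentiable (by norm_num)
  have hA : ∀ i, DifferentiableAt ℝ (fun q => fderiv ℝ G q (e i)) p := fun i =>
    (((hG.fderiv_right (m := 1) (by norm_num)).differentiable one_ne_zero) p).clm_apply
      (differentiableAt_const _)
  -- `D ≠ 0` near `p`, hence `Xᵢ` is differentiable near `p` and the level-one formula holds near `p`
  have hD0 : ∀ᶠ q in 𝓝 p, D q ≠ 0 := hDd.continuous.continuousAt.eventually_ne hDp.ne'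
  have hXfun : ∀ i, X i = fun q => d i q / D q := fun i => funext (hX i)
  have hXdq : ∀ᶠ q in 𝓝 p, ∀ i, DifferentiableAt ℝ (X i) q := by
    filter_upwards [hD0] with q hq
    intro i
    have hfun : X i = fun q => d i q * (D q)⁻¹ := by
      rw [hXfun i]; funext q; exact div_eq_mul_inv _ _
    rw [hfun]
    exact ((hdd i) q).mul ((hDd q).fun_inv hq)
  have hXC : ∀ i, ContDiffAt ℝ 2 (X i) p := fun i => frame_contDiffAt_X hΩ hd hD hX hDp.ne' i
  have hXd : ∀ i, DifferentiableAt ℝ (X i) p := fun i => (hXC i).differentiableAt (by simp)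
  have hB : ∀ i, DifferentiableAt ℝ (fun q => fderiv ℝ (X i) q (e i)) p := fun i =>
    (((hXC i).fderiv_right (m := 1) (by norm_num)).differentiableAt one_ne_zero).clm_apply
      (differentiableAt_const _)
  have hLeq : LG =ᶠ[𝓝 p] fun q => ∑ i, (fderiv ℝ G q (e i) * X i q + G q * fderiv ℝ (X i) q (e i)) := by
    filter_upwards [hXdq] with q hq
    rw [hL q]
    exact frame_L_eq (hGd q) hq
  -- the right-hand side is differentiable at `p`, summand by summand
  have hS : ∀ i, DifferentiableAt ℝ
      (fun q => fderiv ℝ G q (e i) * X i q + G q * fderiv ℝ (X i) q (e i)) p := fun i =>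
    ((hA i).mul (hXd i)).add ((hGd p).mul (hB i))
  have hRd : DifferentiableAt ℝ
      (fun q => ∑ i, (fderiv ℝ G q (e i) * X i q + G q * fderiv ℝ (X i) q (e i))) p :=
    DifferentiableAt.fun_sum fun i _ => hS i
  refine ⟨hRd.congr_of_eventuallyEq hLeq, ?_⟩
  rw [hLeq.fderiv_eq, fderiv_fun_sum fun i _ => hS i, FunLike.coe_sum, Finset.sum_apply]
  -- bound each summand
  have hterm : ∀ i, |fderiv ℝ (fun q => fderiv ℝ G q (e i) * X i q + G q * fderiv ℝ (X i) q (e i))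
      p (e l)| ≤ g₂ * (1 / m) + g₁ * (7 * n / m ^ 2) + (g₁ * (7 * n / m ^ 2) +
        g₀ * (7 * t / m ^ 2 + 102 * n ^ 2 / m ^ 3)) := by
    intro i
    have h1 : DifferentiableAt ℝ (fun q => fderiv ℝ G q (e i) * X i q) p := (hA i).mul (hXd i)
    have h2 : DifferentiableAt ℝ (fun q => G q * fderiv ℝ (X i) q (e i)) p := (hGd p).mul (hB i)
    rw [fderiv_fun_add h1 h2, add_apply, fp_mul (hA i) (hXd i), fp_mul (hGd p) (hB i)]
    refine (abs_add_le _ _).trans (add_le_add ((abs_add_le _ _).trans (add_le_add ?_ ?_))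
      ((abs_add_le _ _).trans (add_le_add ?_ ?_)))
    · rw [abs_mul]
      exact mul_le_mul (hg₂ i l) (frame_abs_X_le hD hX hm hmD i) (abs_nonneg _) hg₂'
    · rw [abs_mul]
      exact mul_le_mul (hg₁ i) (frame_abs_fderiv_X_le hΩ hd hD hX hm hmD i l fun k => hn k l)
        (abs_nonneg _) hg₁'
    · rw [abs_mul]
      exact mul_le_mul (hg₁ l) (frame_abs_fderiv_X_le hΩ hd hD hX hm hmD i i fun k => hn k i)
        (abs_nonneg _) hg₁'
    · rw [abs_mul]
      exact mul_le_mul hg₀ (frame_abs_fderiv2_X_le hΩ hd hD hX hm hmD i i l hn fun k => ht k i l)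
        (abs_nonneg _) hg₀'
  calc |∑ i, fderiv ℝ (fun q => fderiv ℝ G q (e i) * X i q + G q * fderiv ℝ (X i) q (e i)) p (e l)|
      ≤ ∑ i, |fderiv ℝ (fun q => fderiv ℝ G q (e i) * X i q + G q * fderiv ℝ (X i) q (e i)) p (e l)| :=
        Finset.abs_sum_le_sum_abs _ _
    _ ≤ ∑ _i : Fin 3, (g₂ * (1 / m) + g₁ * (7 * n / m ^ 2) + (g₁ * (7 * n / m ^ 2) +
        g₀ * (7 * t / m ^ 2 + 102 * n ^ 2 / m ^ 3))) := Finset.sum_le_sum fun i _ => hterm i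
    _ = 3 * g₂ / m + 42 * g₁ * n / m ^ 2 + 21 * g₀ * t / m ^ 2 + 306 * g₀ * n ^ 2 / m ^ 3 := by
        rw [Finset.sum_const, Finset.card_univ, Fintype.card_fin]
        simp only [nsmul_eq_mul, Nat.cast_ofNat]
        ring

/-- **Level-two bound.** With the notation above and `LG = Σᵢ∂ᵢ(G·Xᵢ)`:
`|Σᵢ∂ᵢ((LG)·Xᵢ)(p)| ≤ 9g₂/m² + 189g₁n/m³ + 63g₀t/m³ + 1359g₀n²/m⁴`. [folklore] -/
theorem frame_LL_abs_le (hΩ : ContDiff ℝ 3 Ω) (hd : ∀ i q, d i q = fderiv ℝ Ω q (e i))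
    (hD : ∀ q, D q = ∑ i, d i q ^ 2) (hX : ∀ i q, X i q = d i q / D q) {p : V} {m n t : ℝ}
    (hm : 0 < m) (hmD : m ^ 2 ≤ D p) (hn : ∀ k j, |fderiv ℝ (d k) p (e j)| ≤ n)
    (ht : ∀ k i l, |fderiv ℝ (fun q => fderiv ℝ (d k) q (e i)) p (e l)| ≤ t)
    {G LG : V → ℝ} (hG : ContDiff ℝ 2 G) (hL : ∀ q, LG q = ∑ i, fderiv ℝ (fun r => G r * X i r) q (e i))
    {g₀ g₁ g₂ : ℝ} (hg₀ : |G p| ≤ g₀) (hg₁ : ∀ i, |fderiv ℝ G p (e i)| ≤ g₁)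
    (hg₂ : ∀ i l, |fderiv ℝ (fun q => fderiv ℝ G q (e i)) p (e l)| ≤ g₂) :
    |∑ i, fderiv ℝ (fun q => LG q * X i q) p (e i)| ≤
      9 * g₂ / m ^ 2 + 189 * g₁ * n / m ^ 3 + 63 * g₀ * t / m ^ 3 + 1359 * g₀ * n ^ 2 / m ^ 4 := by
  have hn0 : 0 ≤ n := (abs_nonneg _).trans (hn 0 0)
  have hg₀' : 0 ≤ g₀ := (abs_nonneg _).trans hg₀
  have hg₁' : 0 ≤ g₁ := (abs_nonneg _).trans (hg₁ 0)
  -- level-one data for `F = LG`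
  have hdiff := (frame_fderiv_L_abs_le hΩ hd hD hX hm hmD hn ht hG hL hg₀ hg₁ hg₂ 0).1
  have hf₁ : ∀ l, |fderiv ℝ LG p (e l)| ≤ 3 * g₂ / m + 42 * g₁ * n / m ^ 2 + 21 * g₀ * t / m ^ 2 +
      306 * g₀ * n ^ 2 / m ^ 3 := fun l =>
    (frame_fderiv_L_abs_le hΩ hd hD hX hm hmD hn ht hG hL hg₀ hg₁ hg₂ l).2
  have hf₀ : |LG p| ≤ 3 * g₁ / m + 21 * g₀ * n / m ^ 2 := by
    rw [hL p]
    exact frame_L_abs_le hΩ hd hD hX hm hmD hn (hG.differentiable (by norm_num) p) hg₀ hg₁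
  refine (frame_L_abs_le hΩ hd hD hX hm hmD hn hdiff hf₀ hf₁).trans (le_of_eq ?_)
  field_simp
  ring

end Frame

/-! ### §4 The registered statement on `ℝ³` -/

/-- **Pointwise bound for the divergence of the two-level gradient flux (registered sub-goal
`flux_pointwise_bound` of stub B1b″; all binders explicit, `V = ℝ³`).** For a `C³` level function `Ω`, a
`C²` amplitude `G`, a frame `e`, with `dᵢ = ∂ᵢΩ`, `D = Σdᵢ²`, `Xᵢ = dᵢ/D`, `LG = Σᵢ∂ᵢ(GXᵢ)`, at a point `p`
where `m² ≤ D(p)` (`m > 0`), `|∂dₖ| ≤ n`, `|∂²dₖ| ≤ t`, `|G| ≤ g₀`, `|∂G| ≤ g₁`, `|∂²G| ≤ g₂` (all at `p`, along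
the frame): `|Σᵢ∂ᵢ((LG)Xᵢ)(p)| ≤ 9g₂/m² + 189g₁n/m³ + 63g₀t/m³ + 1359g₀n²/m⁴`. [folklore] -/
theorem flux_pointwise_bound :
    ∀ (Ω G D LG : ℝ × ℝ × ℝ → ℝ) (e : Fin 3 → ℝ × ℝ × ℝ) (d X : Fin 3 → ℝ × ℝ × ℝ → ℝ) (p : ℝ × ℝ × ℝ)
      (m n t g₀ g₁ g₂ : ℝ), ContDiff ℝ 3 Ω → ContDiff ℝ 2 G →
      (∀ i q, d i q = fderiv ℝ Ω q (e i)) → (∀ q, D q = ∑ i, d i q ^ 2) →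
      (∀ i q, X i q = d i q / D q) → (∀ q, LG q = ∑ i, fderiv ℝ (fun r => G r * X i r) q (e i)) →
      0 < m → m ^ 2 ≤ D p → (∀ k j, |fderiv ℝ (d k) p (e j)| ≤ n) →
      (∀ k i l, |fderiv ℝ (fun q => fderiv ℝ (d k) q (e i)) p (e l)| ≤ t) →
      |G p| ≤ g₀ → (∀ i, |fderiv ℝ G p (e i)| ≤ g₁) →
      (∀ i l, |fderiv ℝ (fun q => fderiv ℝ G q (e i)) p (e l)| ≤ g₂) →
      |∑ i, fderiv ℝ (fun q => LG q * X i q) p (e i)| ≤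
        9 * g₂ / m ^ 2 + 189 * g₁ * n / m ^ 3 + 63 * g₀ * t / m ^ 3 + 1359 * g₀ * n ^ 2 / m ^ 4 :=
  fun _ _ _ _ _ _ _ _ _ _ _ _ _ _ hΩ hG hd hD hX hL hm hmD hn ht hg₀ hg₁ hg₂ =>
    frame_LL_abs_le hΩ hd hD hX hm hmD hn ht hG hL hg₀ hg₁ hg₂

end Summit.AtomisticToContinuum.FouriersLaw.Theorems.DrudeDissolution.KineticPolymerGasOnTheTimeAxis

end
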